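import Summits.CriticalPhenomena.CardyFormulaZ2.Theorems.CardyComplexConeParafermionToSLESixFamiliesDiamondIdentifySupport
import Mathlib.Analysis.Normed.Affine.AddTorsorBases
import HarnessLib

/-!
# Line `potential-darboux-picard-diamond`, stub S4 (`stub_identifyPotential`): the convex hull of the limit trace

Helper file of the stub `stub_identifyPotential` of crux `ParafermionToSLESixFamilies` (stmt-CriticalPhenomena-11389).
Steps (ii)–(iv) of the identification apply `DarbouxPicardConvex` (S2) with `K` = the convex hull of the boundary trace of
the potential limit, a left-turning closed polygonal chain `Q_{m+1} = Q_m + λ_m d_m` (S1 DIR/TURN in the limit, cf.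
`supportingLine_of_leftTurning`). This file packages the convex-geometry facts consumed there
(`leftTurningHull_props`, registered helper of the crux item): `K` is compact and convex, contains every edge point
`Q_m + r d_m` (`0 ≤ r ≤ λ_m`), lies weakly to the left of every edge line, every INTERIOR point of `K` lies STRICTLY to the
left of every edge line (the hypothesis `hleft` of `monotoneArg_of_pieces`), and every edge point lies on `frontier K` (the
boundary hypothesis of `DarbouxPicardConvex`). The degenerate alternative is `exists_line_of_interior_eq_empty`: a
nonempty convex planar set with empty interior lies on a real line `{w | im (e^{−iα} w) = c}` — the input of
`collinearTrace_const_of_jordan` (the limit would be constant, contradicting the non-degenerate free side).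
-/

noncomputable section

namespace Summit.CriticalPhenomena.CardyFormulaZ2.Cruxes.ParafermionToSLESixFamilies.PotentialDarbouxPicardDiamond

open scoped Real ComplexConjugate BigOperators
open Set Metric Complex

/-- **A nonempty convex planar set with empty interior lies on a line** `{w | im (e^{−iα} w) = c}`. -/
theorem exists_line_of_interior_eq_empty (K : Set ℂ) (hK : Convex ℝ K) (hne : K.Nonempty)
    (hint : interior K = ∅) : ∃ α c : ℝ, ∀ w ∈ K, (exp (-((α : ℂ) * I)) * w).im = c := by
  obtain ⟨p, hp⟩ := hne
  have htop : affineSpan ℝ K ≠ ⊤ := fun h => by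
    have := (hK.interior_nonempty_iff_affineSpan_eq_top).2 h
    rw [hint] at this
    exact Set.not_nonempty_empty this
  have hvtop : vectorSpan ℝ K ≠ ⊤ := fun h =>
    htop ((AffineSubspace.affineSpan_eq_top_iff_vectorSpan_eq_top_of_nonempty ℝ ℂ ℂ ⟨p, hp⟩).2 h)
  have hfr : Module.finrank ℝ (vectorSpan ℝ K) ≤ 1 := by
    have := Submodule.finrank_lt hvtop
    rw [Complex.finrank_real_complex] at this
    omega
  have hpr : (vectorSpan ℝ K).IsPrincipal := (Submodule.finrank_le_one_iff_isPrincipal _).1 hfr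
  obtain ⟨a, ha⟩ := @Submodule.IsPrincipal.principal _ _ _ _ _ (vectorSpan ℝ K) hpr
  refine ⟨arg a, (exp (-((arg a : ℂ) * I)) * p).im, fun w hw => ?_⟩
  have hmem : w - p ∈ vectorSpan ℝ K := by
    have := vsub_mem_vectorSpan ℝ hw hp
    rwa [vsub_eq_sub] at this
  rw [ha, Submodule.mem_span_singleton] at hmem
  obtain ⟨c, hc⟩ := hmem
  have hw' : w = p + (c : ℂ) * a := by rw [← real_smul, hc]; ring
  have hrot : exp (-((arg a : ℂ) * I)) * a = (‖a‖ : ℂ) := by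
    have h := norm_mul_exp_arg_mul_I a
    conv_lhs => arg 2; rw [← h]
    rw [mul_left_comm, ← Complex.exp_add, neg_add_cancel, Complex.exp_zero, mul_one]
  rw [hw', mul_add, add_im, show exp (-((arg a : ℂ) * I)) * ((c : ℂ) * a) = ((c * ‖a‖ : ℝ) : ℂ) by
    rw [mul_left_comm, hrot]; push_cast; ring, ofReal_im, add_zero]

/-- A closed half-plane `{w | 0 ≤ im ((w − P) conj d)}` is convex. -/
theorem convex_leftHalfPlane (P d : ℂ) : Convex ℝ {w : ℂ | 0 ≤ ((w - P) * conj d).im} := by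
  intro x hx y hy a b ha hb hab
  simp only [mem_setOf_eq] at hx hy ⊢
  have : (a • x + b • y - P) * conj d = (a : ℂ) * ((x - P) * conj d) + (b : ℂ) * ((y - P) * conj d) := by
    rw [real_smul, real_smul]
    have hab' : (a : ℂ) + b = 1 := by exact_mod_cast hab
    linear_combination (P * conj d) * hab'
  rw [this, add_im, im_ofReal_mul, im_ofReal_mul]
  positivity

/-- **The convex hull of a left-turning closed polygonal chain.** With the data of `supportingLine_of_leftTurning`
(`Q_{m+1} = Q_m + λ_m d_m`, `λ_m ≥ 0`, `d_{m+1} = d_m e^{iε_m}`, `ε_m ∈ [0, π]`, `ε` and `Q` periodic of period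
`N ≥ 1`, `Σ_{m<N} ε_m = 2π`, `d₀ ≠ 0`) and `K := convexHull ℝ (range Q)`: `K` is compact and convex; every edge point
`Q_m + r d_m`, `0 ≤ r ≤ λ_m`, belongs to `K` and to `frontier K`; `K` lies weakly to the left of every directed edge line;
and every interior point of `K` lies strictly to the left of every directed edge line. -/
theorem leftTurningHull_props : ∀ (Q d : ℕ → ℂ) (lam ε : ℕ → ℝ) (N : ℕ), 0 < N → d 0 ≠ 0 → (∀ m, Q (m + 1) = Q m + lam m * d m) → (∀ m, 0 ≤ lam m) → (∀ m, d (m + 1) = d m * exp (ε m * I)) → (∀ m, 0 ≤ ε m ∧ ε m ≤ Real.pi) → (∀ m, ε (m + N) = ε m) → ∑ m ∈ Finset.range N, ε m = 2 * Real.pi → (∀ m, Q (m + N) = Q m) → IsCompact (convexHull ℝ (Set.range Q)) ∧ Convex ℝ (convexHull ℝ (Set.range Q)) ∧ (∀ (m : ℕ) (r : ℝ), 0 ≤ r → r ≤ lam m → Q m + r * d m ∈ convexHull ℝ (Set.range Q)) ∧ (∀ w ∈ convexHull ℝ (Set.range Q), ∀ j : ℕ, 0 ≤ ((w - Q j) *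 (starRingEnd ℂ) (d j)).im) ∧ (∀ w₀ ∈ interior (convexHull ℝ (Set.range Q)), ∀ j : ℕ, 0 < ((w₀ - Q j) * (starRingEnd ℂ) (d j)).im) ∧ (∀ (m : ℕ) (r : ℝ), 0 ≤ r → r ≤ lam m → Q m + r * d m ∈ frontier (convexHull ℝ (Set.range Q))) := by
  intro Q d lam ε N hN hd0 hQ hlam hd hε hper hsum hQper
  set K := convexHull ℝ (Set.range Q) with hK
  -- `range Q` is finite (periodicity)
  have hQk : ∀ m k, Q (m + k * N) = Q m := by
    intro m k
    induction k with
    | zero => simp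
    | succ k ih => rw [Nat.succ_mul, ← add_assoc, hQper, ih]
  have hrange : Set.range Q = Q '' Set.Iio N := by
    refine Subset.antisymm ?_ (image_subset_range _ _)
    rintro _ ⟨m, rfl⟩
    refine ⟨m % N, Nat.mod_lt _ hN, ?_⟩
    conv_rhs => rw [← Nat.mod_add_div m N, mul_comm]
    exact (hQk _ _).symm
  have hfin : (Set.range Q).Finite := by rw [hrange]; exact (finite_Iio N).image Q
  have hcpt : IsCompact K := hfin.isCompact_convexHull ℝ
  have hconv : Convex ℝ K := convex_convexHull ℝ _
  -- all directions are non-zero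
  have hdne : ∀ m, d m ≠ 0 := by
    intro m
    induction m with
    | zero => exact hd0
    | succ m ih => rw [hd m]; exact mul_ne_zero ih (exp_ne_zero _)
  -- edge points are convex combinations of consecutive vertices
  have hedge : ∀ (m : ℕ) (r : ℝ), 0 ≤ r → r ≤ lam m → Q m + r * d m ∈ K := by
    intro m r hr hrl
    have hQm : Q m ∈ K := subset_convexHull ℝ _ (mem_range_self m)
    have hQm1 : Q (m + 1) ∈ K := subset_convexHull ℝ _ (mem_range_self (m + 1))
    rcases hrl.eq_or_lt with rfl | hlt
    · rcases hr.eq_or_lt with h | h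
      · rw [← h]; simpa using hQm
      · have : Q m + (lam m : ℂ) * d m = Q (m + 1) := (hQ m).symm
        rw [this]; exact hQm1
    · have hl : 0 < lam m := hr.trans_lt hlt
      refine hconv.segment_subset hQm hQm1 ⟨1 - r / lam m, r / lam m, by
        rw [sub_nonneg]; exact div_le_one_of_le₀ hrl hl.le, div_nonneg hr hl.le, by ring, ?_⟩
      rw [real_smul, real_smul, hQ m]
      have hl' : (lam m : ℂ) ≠ 0 := by exact_mod_cast hl.ne'
      push_cast
      field_simp
      ring
  -- supporting half-planes
  have hsupp : ∀ w ∈ K, ∀ j : ℕ, 0 ≤ ((w - Q j) * conj (d j)).im := by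
    intro w hw j
    have hsub : Set.range Q ⊆ {w : ℂ | 0 ≤ ((w - Q j) * conj (d j)).im} := by
      rintro _ ⟨i, rfl⟩
      exact supportingLine_of_leftTurning Q d lam ε N hN hd0 hQ hlam hd hε hper hsum hQper i j
    exact convexHull_min hsub (convex_leftHalfPlane (Q j) (d j)) hw
  -- interior points are strictly to the left
  have hstrict : ∀ w₀ ∈ interior K, ∀ j : ℕ, 0 < ((w₀ - Q j) * conj (d j)).im := by
    intro w₀ hw₀ j
    obtain ⟨ρ, hρ, hball⟩ := Metric.isOpen_iff.1 isOpen_interior w₀ hw₀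
    set w₁ : ℂ := w₀ - ((ρ / 2 / ‖d j‖ : ℝ) : ℂ) * (I * d j) with hw₁
    have hdn : 0 < ‖d j‖ := norm_pos_iff.2 (hdne j)
    have hw₁mem : w₁ ∈ K := by
      refine interior_subset (hball ?_)
      rw [mem_ball, hw₁, dist_eq_norm, sub_sub_cancel_left, norm_neg, norm_mul, norm_mul, norm_I, one_mul,
        norm_real, Real.norm_eq_abs, abs_of_pos (by positivity), div_mul_cancel₀ _ hdn.ne']
      linarith
    have h1 := hsupp w₁ hw₁mem j
    have hcalc : ((w₁ - Q j) * conj (d j)).im = ((w₀ - Q j) * conj (d j)).im - ρ / 2 / ‖d j‖ * ‖d j‖ ^ 2 := by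
      have : (w₁ - Q j) * conj (d j) = (w₀ - Q j) * conj (d j) - ((ρ / 2 / ‖d j‖ : ℝ) : ℂ) * I * (d j * conj (d j)) := by
        simp only [hw₁]; ring
      rw [this, mul_conj, sub_im, mul_assoc, im_ofReal_mul, I_mul_im, ofReal_re, normSq_eq_norm_sq]
    rw [hcalc] at h1
    have : 0 < ρ / 2 / ‖d j‖ * ‖d j‖ ^ 2 := by positivity
    linarith
  refine ⟨hcpt, hconv, hedge, hsupp, hstrict, fun m r hr hrl => ?_⟩
  -- edge points are not interior (the edge line through them supports `K`)
  refine ⟨subset_closure (hedge m r hr hrl), fun hint => ?_⟩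
  have h := hstrict _ hint m
  rw [add_sub_cancel_left, mul_assoc, im_ofReal_mul, mul_conj, ofReal_im, mul_zero] at h
  exact lt_irrefl _ h

end Summit.CriticalPhenomena.CardyFormulaZ2.Cruxes.ParafermionToSLESixFamilies.PotentialDarbouxPicardDiamond

end
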